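import Literature.AnabelianGeometry.SemiGraphs.ImageApproximator
import Literature.AnabelianGeometry.SemiGraphs.HomComposition

/-!
# Transport of approximators along finite étale coverings ([SemiAnbd] §2, Def. 2.3 / pp. 29–30)

Mochizuki, *Semi-graphs of anabelioids*, Publ. RIMS **42** (2006), §2 [cite: MochizukiSemiAnbd2006,
Prop. 2.6 p.29]: the proofs of Proposition 2.6 and Corollary 2.7 replace `𝒢` by a finite étale
covering `𝒢' → 𝒢` and use, without comment, that approximators of `𝒢` (Def. 2.3 (ii)) induce
approximators of `𝒢'` (quasi-coherence and elevatedness "pass to coverings", dictionary facts (D5),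
(D6) of `FiniteEtaleCoveringDictionary.lean`).  The TRANSPORT is the image construction of
Remark 2.3.1 (`ImageApproximator.lean`) applied to the composite `χ := φ' ≫ ψ : 𝒢' → 𝒢 → 𝒢₀`
(`HomComposition.lean`): `χ.imageAnabelioids` has underlying semi-graph `𝔾'` and constituents the
image anabelioids of `𝒢'_{v'} → 𝒢₀_{ψφ'v'}` ("the component-wise quotients `Π_{v'}/(Π_{v'} ∩ Ker)`"),
and `χ.toImageAnabelioids : 𝒢' → χ.imageAnabelioids` is a `π₁`-epimorphic approximator as soon as
`𝒢₀` is of bounded order (`Hom.toImageAnabelioids_isPi1EpiApproximator`, already in the tree).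

This small DEFINITION file adds the other factor of the image factorisation, through which the
transported approximator is compared with the original one:

* `Anabelioids.Hom.fromImage φ : I_φ → Y` — the morphism of connected anabelioids with pull-back
  functor `φ^*` corestricted to `I_φ ⊆ X` ([GeoAn] p. 14, "`X → I_φ → Y`"); `φ^* = fromImage^* ⋙ ι`
  definitionally (`fromImage_pullback_comp_ι`), and `φ = toImage ≫ fromImage` (`toImage_comp_fromImage`).

Its `π₁`-injectivity and the transfer lemmas for (D5)/(D6) are in `ApproximatorTransportProofs.lean`.
-/

namespace Literature.AnabelianGeometry.Anabelioids

open CategoryTheory CategoryTheory.Limits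

universe v₁ v₂ u₁ u₂

section Lift

variable {C : Type u₁} [Category.{v₁} C] {D : Type u₂} [Category.{v₂} D] (P : ObjectProperty D)
  (F : C ⥤ D) (hF : ∀ A, P (F.obj A))

/-- A finite-limit-preserving functor lifted to a full subcategory of its target preserves finite
limits. [folklore] -/
private theorem preservesFiniteLimits_lift' [PreservesFiniteLimits F] :
    PreservesFiniteLimits (P.lift F hF) := by
  refine ⟨fun J _ _ => ?_⟩
  haveI : PreservesLimitsOfShape J (P.lift F hF ⋙ P.ι) :=
    preservesLimitsOfShape_of_natIso (P.liftCompιIso F hF).symm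
  exact preservesLimitsOfShape_of_reflects_of_preserves (P.lift F hF) P.ι

/-- A finite-colimit-preserving functor lifted to a full subcategory of its target preserves finite
colimits. [folklore] -/
private theorem preservesFiniteColimits_lift' [PreservesFiniteColimits F] :
    PreservesFiniteColimits (P.lift F hF) := by
  refine ⟨fun J _ _ => ?_⟩
  haveI : PreservesColimitsOfShape J (P.lift F hF ⋙ P.ι) :=
    preservesColimitsOfShape_of_natIso (P.liftCompιIso F hF).symm
  exact preservesColimitsOfShape_of_reflects_of_preserves (P.lift F hF) P.ι

end Lift

section FromImage

variable {X : Type u₁} [Category.{v₁} X] {Y : Type u₂} [Category.{v₂} Y] (φ : Hom X Y)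

/-- The objects `φ^* B` lie in the image `I_φ`. [cite: MochizukiGeoAn2004, Def. 1.1.7(i) p.14] -/
theorem imageObj_pullback_obj (B : Y) : imageObj φ.pullback (φ.pullback.obj B) :=
  ⟨B, _, 𝟙 _, 𝟙 _, inferInstance, inferInstance⟩

/-- **The morphism `I_φ → Y`** through which `φ : X → Y` factors ([GeoAn] p. 14, "`X → I_φ → Y`"):
its pull-back functor is `φ^*` corestricted to the image `I_φ ⊆ X`.
[cite: MochizukiGeoAn2004, §1.1 p.14] -/
noncomputable def Hom.fromImage : Hom (Image φ.pullback) Y :=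
  haveI := preservesFiniteLimits_lift' (imageObj φ.pullback) φ.pullback (imageObj_pullback_obj φ)
  haveI := preservesFiniteColimits_lift' (imageObj φ.pullback) φ.pullback (imageObj_pullback_obj φ)
  ExactFunctor.of ((imageObj φ.pullback).lift φ.pullback (imageObj_pullback_obj φ))

/-- The pull-back functor of `I_φ → Y` is the lift of `φ^*`. [cite: MochizukiGeoAn2004, §1.1 p.14] -/
theorem Hom.fromImage_pullback :
    (Hom.fromImage φ).pullback =
      (imageObj φ.pullback).lift φ.pullback (imageObj_pullback_obj φ) := rfl

/-- `φ^* = (I_φ → Y)^* ⋙ ι` definitionally. [cite: MochizukiGeoAn2004, §1.1 p.14] -/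
theorem Hom.fromImage_pullback_comp_ι :
    (Hom.fromImage φ).pullback ⋙ (imageObj φ.pullback).ι = φ.pullback := rfl

/-- On objects, `(I_φ → Y)^*` is `φ^*`. [cite: MochizukiGeoAn2004, §1.1 p.14] -/
@[simp] theorem Hom.fromImage_pullback_obj (B : Y) :
    ((Hom.fromImage φ).pullback.obj B).obj = φ.pullback.obj B := rfl

/-- On morphisms, `(I_φ → Y)^*` is `φ^*`. [cite: MochizukiGeoAn2004, §1.1 p.14] -/
@[simp] theorem Hom.fromImage_pullback_map {B B' : Y} (f : B ⟶ B') :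
    ((Hom.fromImage φ).pullback.map f).hom = φ.pullback.map f := rfl

/-- **The image factorisation `φ = (X → I_φ) ≫ (I_φ → Y)`** ([GeoAn] p. 14), an equality of
morphisms of anabelioids (composition of pull-back functors is strictly associative).
[cite: MochizukiGeoAn2004, §1.1 p.14] -/
theorem Hom.toImage_comp_fromImage [GaloisCategory X] [GaloisCategory Y] :
    (Hom.toImage φ).comp (Hom.fromImage φ) = φ := rfl

end FromImage

end Literature.AnabelianGeometry.Anabelioids

namespace Literature.AnabelianGeometry.SemiGraphs

open CategoryTheory CategoryTheory.Limits
open Literature.AnabelianGeometry.Anabelioids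

universe v₁ u₁ u

namespace SemiGraphOfAnabelioids

variable {𝒢 𝒢₀ : SemiGraphOfAnabelioids.{v₁, u₁, u}} (χ : Hom 𝒢 𝒢₀)

/-- The edge components of the factor `χ.imageAnabelioids → 𝒢₀`, at an arbitrary presentation
`f` of the target edge (transport by `subst`, as for `Hom.φE`). [cite: MochizukiSemiAnbd2006, Rem. 2.3.1 p.25] -/
noncomputable def Hom.fromImageE (e : 𝒢.graph.Edge) (f : 𝒢₀.graph.Edge)
    (hf : χ.base.edgeMap e = f) : Anabelioids.Hom (χ.imageAnabelioids.E e) (𝒢₀.E f) := by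
  subst hf
  exact Hom.fromImage (χ.φE e (χ.base.edgeMap e) rfl)

/-- At the canonical presentation the edge component is `fromImage`.
[cite: MochizukiSemiAnbd2006, Rem. 2.3.1 p.25] -/
@[simp] theorem Hom.fromImageE_rfl (e : 𝒢.graph.Edge) :
    χ.fromImageE e (χ.base.edgeMap e) rfl = Hom.fromImage (χ.φE e (χ.base.edgeMap e) rfl) := rfl

/-- `χ_e^* = (fromImageE)^* ⋙ ι` for every presentation of the target edge.
[cite: MochizukiSemiAnbd2006, Rem. 2.3.1 p.25] -/
theorem Hom.fromImageE_pullback_comp_ι (e : 𝒢.graph.Edge) (f : 𝒢₀.graph.Edge)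
    (hf : χ.base.edgeMap e = f) :
    (χ.fromImageE e f hf).pullback ⋙ (imageObj (χ.φE e (χ.base.edgeMap e) rfl).pullback).ι =
      (χ.φE e f hf).pullback := by
  subst hf
  rfl

/-- **The factor `χ.imageAnabelioids → 𝒢₀` of `χ : 𝒢 → 𝒢₀`** through the semi-graph of image
anabelioids: same underlying morphism of semi-graphs as `χ`, components the factors
`I_{χ,v} → 𝒢₀,v`, `I_{χ,e} → 𝒢₀,e` of [GeoAn] p. 14, and 2-cells those of `χ` read on the images
(cancelling the fully faithful inclusions `ι`). [cite: MochizukiSemiAnbd2006, Rem. 2.3.1 p.25] -/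
noncomputable def Hom.fromImageAnabelioids : Hom χ.imageAnabelioids 𝒢₀ where
  base := χ.base
  φV v := Hom.fromImage (χ.φV v)
  φE e f hf := χ.fromImageE e f hf
  φB b v h := by
    -- the inclusion `ι` is fully faithful (instances supplied explicitly: the constituent
    -- `χ.imageAnabelioids.E e` is the full subcategory only up to unfolding)
    refine @Functor.fullyFaithfulCancelRight _ _ _ _ _ _ _ _
      (imageObj (χ.φE (𝒢.graph.edgeOf b) (χ.base.edgeMap (𝒢.graph.edgeOf b)) rfl).pullback).ι
      (ObjectProperty.full_ι _) (ObjectProperty.faithful_ι _) ?_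
    exact χ.φB b v h ≪≫
      Functor.isoWhiskerLeft _ (eqToIso (χ.fromImageE_pullback_comp_ι _ _ _).symm) ≪≫
        (Functor.associator _ _ _).symm

/-- The factor lies over the same morphism of semi-graphs as `χ`.
[cite: MochizukiSemiAnbd2006, Rem. 2.3.1 p.25] -/
@[simp] theorem Hom.fromImageAnabelioids_base : χ.fromImageAnabelioids.base = χ.base := rfl

/-- Vertex components of the factor. [cite: MochizukiSemiAnbd2006, Rem. 2.3.1 p.25] -/
@[simp] theorem Hom.fromImageAnabelioids_φV (v : 𝒢.graph.Vertex) :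
    χ.fromImageAnabelioids.φV v = Hom.fromImage (χ.φV v) := rfl

/-- Edge components of the factor. [cite: MochizukiSemiAnbd2006, Rem. 2.3.1 p.25] -/
@[simp] theorem Hom.fromImageAnabelioids_φE (e : 𝒢.graph.Edge) (f : 𝒢₀.graph.Edge)
    (hf : χ.base.edgeMap e = f) : χ.fromImageAnabelioids.φE e f hf = χ.fromImageE e f hf := rfl

/-- `χ_v^* = (factor)_v^* ⋙ (𝒢 → image)_v^*` on vertex components (definitionally).
[cite: MochizukiSemiAnbd2006, Rem. 2.3.1 p.25] -/
theorem Hom.fromImageAnabelioids_φV_comp (v : 𝒢.graph.Vertex) :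
    (χ.fromImageAnabelioids.φV v).pullback ⋙ (χ.toImageAnabelioids.φV v).pullback =
      (χ.φV v).pullback := rfl

end SemiGraphOfAnabelioids

end Literature.AnabelianGeometry.SemiGraphs
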